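import Summits.HodgeConjecture.HodgeConjecture.Theorems.CurveNetMordellWeilLefschetzOneOne
import Summits.HodgeConjecture.HodgeConjecture.Theorems.NikulinTwinTransportLefschetzOneOneK3AlgebraicTwist
import Literature.AlgebraicGeometry.HodgeTheory.KodairaSerreSections

/-!
# Route CurveNetMordellWeil — support item `LefschetzOneOne` (stmt-HodgeConjecture-8544): the smallest residual input

Helper file (`--supports stmt-HodgeConjecture-8544`), companion of
`Theorems/CurveNetMordellWeilLefschetzOneOne` (the item closed modulo each catalogued input:
`lefschetzOneOne_rational`, GAGA for line bundles, Voisin I Thm. 11.32 `⊆`, the meromorphic-section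
lemma, Kodaira–Serre sections `σ₁, σ₂`). Everything in the proof of the item except the EXISTENCE of
holomorphic sections is a theorem of the tree
(`Theorems/NikulinTwinTransportLefschetzOneOneK3AlgebraicTwist`,
`lefschetzOneOne_rational_of_exists_section_algebraicTwist`: the canonical holomorphic section `s^an`
of `𝒪_X(D)^an`, the meromorphic section `σ/s^an`, Čech integrality, the Weil–Kostant heart, rigidity
of natural comparison families, Chow's theorem, universal coefficients, `c₁(𝒪_X(D)^an) ∈ N¹H²`). The
residual is the third sentence of Voisin's proof of Cor. 11.34 — "for sufficiently large `N`,
`L ⊗ H^{⊗N}` and `H^{⊗N}` admit non-zero holomorphic sections `σ₁, σ₂`" — with `H^{⊗N} = 𝒪_X(N·H)^an`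
algebraic and `σ₂` its canonical algebraic section; it is the tree's named fact
`Literature.AlgebraicGeometry.HodgeTheory.kodairaSerre_exists_globalSection_algebraicTwist`
(`Literature/AlgebraicGeometry/HodgeTheory/KodairaSerreSections`; weaker than GAGA for line bundles
`serreGAGA_lineCocycle_iso_cartierDivisorCocycle`: one section after an algebraic twist, no
algebraisation of the bundle). This file records the one-liner closing the item MODULO it:

* `lefschetzOneOne_of_kodairaSerreSections` — the item from the named fact (CONDITIONAL; the item
  itself stays open until the fact is discharged in `Literature/`).
-/

noncomputable section

-- Single-problem summit: the namespace `Summit.HodgeConjecture.HodgeConjecture.…` repeats the summit name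
-- by design (D-0017); the lakefile turns `linter.dupNamespace` off for the `Summits` library, repeated
-- here so that stand-alone elaboration of this file is warning-free too.
set_option linter.dupNamespace false

namespace Summit.HodgeConjecture.HodgeConjecture.Theorems

open Literature.AlgebraicGeometry.HodgeTheory

/-- **The item from the Kodaira–Serre existence of ONE non-zero holomorphic section of an algebraic
twist `L ⊗ 𝒪_X(D)^an`** (the named fact
`Literature.AlgebraicGeometry.HodgeTheory.kodairaSerre_exists_globalSection_algebraicTwist`: Voisin I,
proof of Cor. 11.34, "for sufficiently large `N`, `L ⊗ H^{⊗N}` and `H^{⊗N}` admit non-zero holomorphic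
sections"; the rest — `s^an`, `σ/s^an`, Čech integrality, the Weil–Kostant heart, rigidity, Chow,
universal coefficients — is `lefschetzOneOne_rational_of_exists_section_algebraicTwist` of
`Theorems/NikulinTwinTransportLefschetzOneOneK3AlgebraicTwist`, proved, composed with
`lefschetzOneOne_of_lefschetzOneOne_rational`). This is the smallest input to which the tree has
reduced the item. [cite: VoisinHodgeI2002, Thm. 11.30, Cor. 11.34 (proof) and §11.3.2] -/
theorem lefschetzOneOne_of_kodairaSerreSections
    (h : Literature.AlgebraicGeometry.HodgeTheory.kodairaSerre_exists_globalSection_algebraicTwist) :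
    Summit.HodgeConjecture.HodgeConjecture.Theses.CurveNetMordellWeil.LefschetzOneOne :=
  lefschetzOneOne_of_lefschetzOneOne_rational (lefschetzOneOne_rational_of_exists_section_algebraicTwist h)

end Summit.HodgeConjecture.HodgeConjecture.Theorems

end
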